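import Summits.QuantumFields.YangMills.Theorems.BalabanUVNodesPortTok182WholeTorus
import Literature.MathematicalPhysics.QuantumFieldTheory.Balaban1983to89.B5Positivity172Lattice

/-!
# PORT order O-Tok182 (docket O-10), file 2 — THE SELECTOR-FREE CRITERION FOR Tok-182 AT THE NAMES: given the (T‴)-shape «rooted response = chart-unit whole-torus
# localized response + a fine gauge term `∂Φ`» (DISPLAYED, any potential `Φ`), Tok-182 `recordHr = recordHrLocξ … univ` holds **iff the `(k+1)`-block means of `Φ` are
# constant** — director-ym №508 (2)(i) last clause, ◆ CRIT-1 04:49:39Z (1) «ZERO iff `m` is block-constant» in kernel (`Q′_{k+1}Φ = −m + const`)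

Cell `ym-nodeO-ideate` ∕ `ym-balaban-port`, porter lineage `ymgap-nodeO-port-PTZ-1` (gen 4, HELPER MODE).  `--supports stmt-QuantumFields-27931 --as helper` (never `--workitem`).
[B5] = [Balaban1984PropagatorsI], [B6] = [Balaban1984PropagatorsII], [B7] = [Balaban1985Averaging], [15] = [Balaban1985Variational], [I] = [Balaban1987RG1].

THE MATHEMATICS (one paragraph).  The (21)-Landau re-gauging `landauRep x = x − ∂(landauPot x)` subtracts THE potential with vanishing `(k+1)`-block means that puts `x` in the
Landau subspace `lan` ([B6] (2.12) at the whole torus, `existsUnique_landauGauge`).  Hence for a gauge translate `x + ∂φ`: **`landauRep (x + ∂φ) = landauRep x` iff `Q′_{k+1}φ`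
is CONSTANT** (§2: «⇐» the potential `landauPot x − φ + κ` has the spec; «⇒» apply the straight mean `Q_{k+1}`, which the re-gauging preserves (file 1), and read
`Q_{k+1}∂φ = L^{−(k+1)}·∂′(Q′_{k+1}φ)` ([B5] (1.20), `bondAvgIter_grad`) through the connectivity of the coarse torus (§1)).  At the names (§4): if the rooted response is
`recordD a l b = recordHrLocξ univ a l b + (Φ b₊ − Φ b₋)` entrywise for SOME `Φ` (the (T‴)-shape of memo v1 ∕ CRIT-1 (1) — DISPLAYED, nothing about the selector `UkSel` is
proved here), then, since every entry of `recordHrLocξ … univ` is a real multiple of the whole-torus response `windowResp … univ l ∈ lan` (§3, [B6] (2.12)-admissibility of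
`hOp` read through file 1's `windowDomains_univ_eq_whole`), **Tok-182 at `(θ, K, a, l)` ⟺ the `(k+1)`-block means of `re Φ_{ii′}` and `im Φ_{ii′}` are constant for every entry**.
In the finite model of memo v2 (`pub/ym-nodeO-ideate/ymgap-nodeO-port-PTZ-1/O-Tok182-MEMO-v2.md`) these block means are the comb∕flux data `−m + const`, NOT constant already at
`k = 0` in `d = 4` (max deviation 38–111 % of `‖X₁‖_∞`).

WHAT THIS FILE PROVES (theorems only; 0 `def ∕ instance ∕ notation ∕ sorry`; standard axioms), standing range `k + 1 ≤ m + K`: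
* §1 `const_of_grad_eq_zero` — a site field on `T^{(j)}` with vanishing lattice gradient is constant (connectivity via the tree's coordinate paths `T4RootedResidualGauge.pathEnd_finRange`).
* §2 `bondAvgIter_ofLp_landauRep` (the re-gauging preserves `Q_{k+1}`), `landauRep_eq_self_of_mem_lan`, ★ `landauRep_add_grad_of_blockConst`, ★ `blockConst_of_landauRep_add_grad`,
  ★★ `landauRep_add_grad_eq_iff` — **`landauRep (x + ∂φ) = landauRep x ↔ ∃ κ, Q′_{k+1}φ ≡ κ`**.
* §3 `toLp_windowResp_univ_mem_lan` — the whole-torus scalar response is a Landau field ([B6] (2.12) half of admissibility, at `Domains.whole (k+1)`).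
* §4 `landauRepC_eq_iff_blockConst` (complex∕entrywise form of §2 against a Landau field `R`) and ★★★ `tok182At_iff_blockConst_of_gaugeShape` — AT THE NAMES: under the displayed
  (T‴)-shape with potential `Φ`, `(∀ b, recordHr F θ k K a l b = recordHrLocξ F θ k K Finset.univ a l b) ↔ ∀ i i′, (∃ κ, Q′_{k+1}(re Φ · i i′) ≡ κ) ∧ (∃ κ, Q′_{k+1}(im Φ · i i′) ≡ κ)`;
  one-way corollary `not_tok182At_of_gaugeShape_of_not_blockConst` (a non-constant block mean of the gauge potential refutes Tok-182 at `(θ, K, a, l)`).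

HONEST FRAMING.  Linear-algebra bookkeeping over DEF-1's ed.14∕16∕16c names, r03's [B5]∕[B6] files and file 1; the (T‴)-shape is a HYPOTHESIS (its potential `Φ` is whatever
[15] (182) ∕ the JOIN side supplies — e.g. DEF-1 ed.17's `recordChiLocξ` when it lands); nothing of Bałaban asserted, ported, discharged or refuted; Tok-182 FALSE-SHAPED ·
KERNEL-UNDECIDABLE (CRIT-1 (3)); 27931 SIGNED v11-G₄ · OPEN · UNPROVED (№508: closes implication-only); K0⁷ OPEN; NODE O 0∕1; COUNT 8∕28 · K 1∕4 UNMOVED; finite `𝕋⁴_{L^K}` at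
fixed ε — NOT continuum ∕ OS ∕ Clay; **the Yang–Mills mass gap (Clay) is NOT proved by any of this.**
-/

noncomputable section

open scoped BigOperators

namespace Summit.QuantumFields.YangMills.Theorems.PortTok182

open Literature.MathematicalPhysics.QuantumFieldTheory.Balaban1983to89
open Literature.MathematicalPhysics.QuantumFieldTheory.Balaban1983to89.Node00
open Literature.MathematicalPhysics.QuantumFieldTheory.Balaban1983to89.T4Continuum (T4Family)
open Literature.MathematicalPhysics.QuantumFieldTheory.Balaban1983to89.LatticeFieldCalculus (siteAvgIter bondAvgIter grad siteAvg_const)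
open Literature.MathematicalPhysics.QuantumFieldTheory.Balaban1983to89.B6SectADomainsV1 (Domains)
open Literature.MathematicalPhysics.QuantumFieldTheory.Balaban1983to89.B6SectAOperatorsV1 (QE QsE RE dsE BondIdx ScalarSpace)
open Literature.MathematicalPhysics.QuantumFieldTheory.Balaban1983to89.B6SectAVectorModelV1 (GE EE)
open Literature.MathematicalPhysics.QuantumFieldTheory.BalabanImbrieJaffe1984to88.BIJ85AxialPropagator411 (BondSpace)
open Literature.MathematicalPhysics.QuantumFieldTheory.BalabanImbrieJaffe1984to88.BIJ85LandauMinimizer442V1 (gradV1 gradV1_apply)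
open Literature.MathematicalPhysics.QuantumFieldTheory.BalabanImbrieJaffe1984to88.BIJ85GaugeFunction5113 (grad_zero)
open Literature.MathematicalPhysics.QuantumFieldTheory.Balaban1983to89.B5Eq120IterProof (bondAvgIter_grad siteAvgIter_succ)
open Literature.MathematicalPhysics.QuantumFieldTheory.Balaban1983to89.B6SectAOntoV1 (bondAvgIterLin siteAvgIterLin bondAvgIterLin_apply siteAvgIterLin_apply)
open Literature.MathematicalPhysics.QuantumFieldTheory.Balaban1983to89.B5AveragingLocalityV1 (siteAvgIter_map_zero)
open Literature.MathematicalPhysics.QuantumFieldTheory.Balaban1983to89.B5Eq164LandauV1 (lan)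
open Literature.MathematicalPhysics.QuantumFieldTheory.Balaban1983to89.T4RootedResidualGauge (shiftN shiftN_zero shiftN_succ steps pathEnd pathEnd_finRange)
open Summit.QuantumFields.YangMills.Theorems.K0RecordFormatNames

variable (F : T4Family)

/-! ## §1  Connectivity of the torus: vanishing gradient ⇒ constant -/

/-- **A site field with vanishing lattice gradient (`c ≠ 0`) is constant** on the torus `T^{(j)}`: along every bond `f(b₊) = f(b₋)`, hence along every straight line, hence along the
tree's coordinate path from `a` to `x` (`T4RootedResidualGauge.pathEnd_finRange`: through all `d` directions the path ends at `x`). [cite: Balaban1984PropagatorsI, p.22 (text: constants on the lattices); Balaban1985Averaging, (8) p.19 (bookkeeping)] -/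
theorem const_of_grad_eq_zero {P : Params} {j : ℕ} {V : Type*} [AddCommGroup V] [Module ℝ V] {c : ℝ} (hc : c ≠ 0) {f : Site P j → V}
    (h : grad c f = 0) (a x : Site P j) : f x = f a := by
  have hstep : ∀ (z : Site P j) (μ : Fin P.d), f (z.shift μ) = f z := fun z μ => by
    have h1 : c • (f (z.shift μ) - f z) = 0 := congrFun h ⟨z, μ⟩
    rcases smul_eq_zero.mp h1 with h0 | h0
    · exact absurd h0 hc
    · exact sub_eq_zero.mp h0
  have hline : ∀ (z : Site P j) (μ : Fin P.d) (n : ℕ), f (shiftN z μ n) = f z := fun z μ n => by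
    induction n with
    | zero => rw [shiftN_zero]
    | succ n ih => rw [shiftN_succ, hstep, ih]
  have hpath : ∀ (l : List (Fin P.d)) (z : Site P j), f (pathEnd z x l) = f z := fun l => by
    induction l with
    | nil => intro z; rfl
    | cons μ l ih => intro z; rw [pathEnd, ih, hline]
  have := hpath (List.finRange P.d) a
  rwa [pathEnd_finRange] at this

/-! ## §2  Landau representatives of gauge translates: `landauRep (x + ∂φ) = landauRep x ↔ Q′_{k+1}φ` constant -/

section Landau

variable {k K : ℕ} (hk : k + 1 ≤ (F.P K).m + (F.P K).K)
include hk

/-- **The (21)-Landau re-gauging preserves the straight `(k+1)`-fold means** (real scalar form of file 1's `bondAvgIter_recordHr_eq_recordD`): `Q_{k+1}(landauRep x) = Q_{k+1}x`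
([B5] (1.20) at a potential with `Q′_{k+1} = 0`). [cite: Balaban1984PropagatorsI, (1.20) p.20; Balaban1984PropagatorsII, (2.12) p.225] -/
theorem bondAvgIter_ofLp_landauRep (x : BondSpace (F.P K)) :
    bondAvgIter (k + 1) (WithLp.ofLp (landauRep F k K x)) = bondAvgIter (k + 1) (WithLp.ofLp x) := by
  have hsub : WithLp.ofLp (landauRep F k K x) = WithLp.ofLp x - grad 1 (WithLp.ofLp (landauPot F k K x)) := by
    simp only [landauRep, WithLp.ofLp_sub, gradV1_apply]
  rw [hsub, ← bondAvgIterLin_apply (P := F.P K) (V := ℝ), map_sub, bondAvgIterLin_apply, bondAvgIterLin_apply,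
    bondAvgIter_grad (k + 1) hk 1 _, (landauPot_spec F hk x).1, grad_zero, sub_zero]

/-- A Landau field is its own Landau representative (the potential `0` has the spec; uniqueness). [cite: Balaban1984PropagatorsII, (2.12) p.225; Balaban1985Variational, (21) p.281] -/
theorem landauRep_eq_self_of_mem_lan {x : BondSpace (F.P K)} (hx : x ∈ lan (F.P K) (k + 1) 1 1) : landauRep F k K x = x := by
  have h0 : landauPot F k K x = 0 :=
    landauPot_eq_of_spec F hk x ⟨by rw [WithLp.ofLp_zero]; exact siteAvgIter_map_zero (P := F.P K) (V := ℝ) (k + 1),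
      by rwa [map_zero, sub_zero]⟩
  show x - gradV1 (F.P K) 1 (landauPot F k K x) = x
  rw [h0, map_zero, sub_zero]

/-- ★ **«⇐»: a gauge translate by a potential with CONSTANT `(k+1)`-block means has the same Landau representative** — the potential `landauPot x − φ + κ` has vanishing block means
and carries `x + ∂φ` onto `landauRep x ∈ lan`; uniqueness ([B6] (2.12)). [cite: Balaban1984PropagatorsII, (2.10)–(2.12) p.225; Balaban1984PropagatorsI, (1.20) p.20] -/
theorem landauRep_add_grad_of_blockConst (x : BondSpace (F.P K)) (φ : ScalarSpace (F.P K)) (κ : ℝ)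
    (hφ : siteAvgIter (k + 1) (WithLp.ofLp φ) = fun _ => κ) :
    landauRep F k K (x + gradV1 (F.P K) 1 φ) = landauRep F k K x := by
  set n' : ScalarSpace (F.P K) := landauPot F k K x + φ - WithLp.toLp 2 (fun _ => κ) with hn'
  have hgrad : gradV1 (F.P K) 1 n' = gradV1 (F.P K) 1 (landauPot F k K x) + gradV1 (F.P K) 1 φ := by
    have hconst : gradV1 (F.P K) 1 (WithLp.toLp 2 (fun _ : Site (F.P K) 0 => κ)) = 0 := by
      apply WithLp.ofLp_injective 2
      funext b
      simp [gradV1_apply, grad]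
    rw [hn', map_sub, map_add, hconst, sub_zero]
  have hspec : siteAvgIter (k + 1) (WithLp.ofLp n') = 0 ∧ (x + gradV1 (F.P K) 1 φ) - gradV1 (F.P K) 1 n' ∈ lan (F.P K) (k + 1) 1 1 := by
    refine ⟨?_, ?_⟩
    · have e : WithLp.ofLp n' = WithLp.ofLp (landauPot F k K x) + WithLp.ofLp φ - fun _ => κ := by
        simp only [hn', WithLp.ofLp_add, WithLp.ofLp_sub]
      rw [e, ← siteAvgIterLin_apply (P := F.P K) (V := ℝ), map_sub, map_add, siteAvgIterLin_apply, siteAvgIterLin_apply, siteAvgIterLin_apply,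
        (landauPot_spec F hk x).1, hφ, B5Positivity172Lattice.siteAvgIter_const κ (k + 1)]
      funext y
      simp
    · have e : x + gradV1 (F.P K) 1 φ - gradV1 (F.P K) 1 n' = x - gradV1 (F.P K) 1 (landauPot F k K x) := by
        rw [hgrad]; abel
      rw [e]
      exact (landauPot_spec F hk x).2
  have hpot : landauPot F k K (x + gradV1 (F.P K) 1 φ) = n' := landauPot_eq_of_spec F hk _ hspec
  show (x + gradV1 (F.P K) 1 φ) - gradV1 (F.P K) 1 (landauPot F k K (x + gradV1 (F.P K) 1 φ)) = x - gradV1 (F.P K) 1 (landauPot F k K x)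
  rw [hpot, hgrad]
  abel

/-- ★ **«⇒»: equal Landau representatives force CONSTANT `(k+1)`-block means of the potential** — apply the straight mean `Q_{k+1}` (preserved by the re-gauging): `Q_{k+1}∂φ = 0`,
i.e. `∂′(Q′_{k+1}φ) = 0` with the coarse factor `L^{−(k+1)} ≠ 0` ([B5] (1.20)), and the coarse torus is connected (§1). [cite: Balaban1984PropagatorsI, (1.20) p.20; Balaban1984PropagatorsII, (2.12) p.225] -/
theorem blockConst_of_landauRep_add_grad (x : BondSpace (F.P K)) (φ : ScalarSpace (F.P K))
    (h : landauRep F k K (x + gradV1 (F.P K) 1 φ) = landauRep F k K x) :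
    ∃ κ : ℝ, siteAvgIter (k + 1) (WithLp.ofLp φ) = fun _ => κ := by
  have hQ : bondAvgIter (k + 1) (WithLp.ofLp (landauRep F k K (x + gradV1 (F.P K) 1 φ))) = bondAvgIter (k + 1) (WithLp.ofLp (landauRep F k K x)) := by
    rw [h]
  rw [bondAvgIter_ofLp_landauRep F hk, bondAvgIter_ofLp_landauRep F hk, WithLp.ofLp_add, gradV1_apply, WithLp.ofLp_toLp,
    ← bondAvgIterLin_apply (P := F.P K) (V := ℝ), map_add, bondAvgIterLin_apply, bondAvgIterLin_apply, add_eq_left,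
    bondAvgIter_grad (k + 1) hk 1 _] at hQ
  have hc : (1 : ℝ) / ((F.P K).L : ℝ) ^ (k + 1) ≠ 0 := by
    have hL : (0 : ℝ) < ((F.P K).L : ℝ) := by exact_mod_cast (F.P K).L_pos
    positivity
  exact ⟨siteAvgIter (k + 1) (WithLp.ofLp φ) default, funext fun y => const_of_grad_eq_zero hc hQ default y⟩

/-- ★★ **THE GAUGE CRITERION FOR THE (21)-LANDAU REPRESENTATIVE**: `landauRep (x + ∂φ) = landauRep x ↔ ∃ κ, Q′_{k+1}φ ≡ κ` — a fine gauge transformation is invisible to the Landau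
re-gauging EXACTLY when its potential has constant `(k+1)`-block means (then and only then it stays inside the `Q_{k+1}`-fibre). [cite: Balaban1984PropagatorsII, (2.12) p.225; Balaban1984PropagatorsI, (1.20) p.20; Balaban1985Variational, (21) p.281] -/
theorem landauRep_add_grad_eq_iff (x : BondSpace (F.P K)) (φ : ScalarSpace (F.P K)) :
    landauRep F k K (x + gradV1 (F.P K) 1 φ) = landauRep F k K x ↔ ∃ κ : ℝ, siteAvgIter (k + 1) (WithLp.ofLp φ) = fun _ => κ :=
  ⟨blockConst_of_landauRep_add_grad F hk x φ, fun ⟨κ, hκ⟩ => landauRep_add_grad_of_blockConst F hk x φ κ hκ⟩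

/-! ## §3  The whole-torus scalar response is a Landau field -/

/-- **`windowResp … univ l ∈ lan`**: the (2.12)-half `R∂*A = 0` of the admissibility of THE critical configuration `hOp` at the window family `univ` (`(isCritical_hOp_V1 …).1.2`),
transported along file 1's `windowDomains_univ_eq_whole` to `Domains.whole (k+1)` and read through the bridge `RE_dsE_whole_eq_zero_iff_mem_lan` as membership in [B5] (1.47)'s
Landau subspace. [cite: Balaban1984PropagatorsII, (2.12) p.225, (2.35) p.228; Balaban1984PropagatorsI, (1.47) p.26] -/
theorem toLp_windowResp_univ_mem_lan (l : RespLabel F k K) :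
    WithLp.toLp 2 (windowResp F k K Finset.univ l) ∈ lan (F.P K) (k + 1) 1 1 := by
  classical
  have hw : ∀ _ : BondIdx (windowDomains F k K hk Finset.univ), (0 : ℝ) < 1 := fun _ => one_pos
  have hadm := (B6SectACriticalPointV1.isCritical_hOp_V1 (windowDomains F k K hk Finset.univ) (one_ne_zero (α := ℝ)) hw
    (windowSrc F k K hk Finset.univ l)).1.2
  have hfun : windowResp F k K Finset.univ l =
      WithLp.ofLp (B6SectA.hOp (GE (windowDomains F k K hk Finset.univ) (one_ne_zero (α := ℝ)) hw) (QsE (windowDomains F k K hk Finset.univ))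
        (EE (windowDomains F k K hk Finset.univ) (one_ne_zero (α := ℝ)) hw) (windowSrc F k K hk Finset.univ l)) := by
    funext b
    unfold windowResp
    rw [dif_pos hk]
  generalize hX : B6SectA.hOp (GE (windowDomains F k K hk Finset.univ) (one_ne_zero (α := ℝ)) hw) (QsE (windowDomains F k K hk Finset.univ))
      (EE (windowDomains F k K hk Finset.univ) (one_ne_zero (α := ℝ)) hw) (windowSrc F k K hk Finset.univ l) = X at hadm hfun
  rw [windowDomains_univ_eq_whole F hk] at hadm
  rw [hfun, WithLp.toLp_ofLp]
  exact (B6SectAWholeTorusBridge.RE_dsE_whole_eq_zero_iff_mem_lan (s := (1 : ℝ)) hk 1 one_ne_zero X).1 hadm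

end Landau

/-! ## §4  The criterion at the names: Tok-182 ⟺ block-constant gauge potential (given the (T‴)-shape) -/

section Names

variable {k K : ℕ} (hk : k + 1 ≤ (F.P K).m + (F.P K).K)
include hk

/-- **Complex∕entrywise form of §2 against a Landau field**: if `x = R + ∂Φ₀` bondwise with `re R, im R ∈ lan`, then `landauRepC x = R ↔` the `(k+1)`-block means of `re Φ₀` and of
`im Φ₀` are constant. [cite: Balaban1985Variational, (21) p.281; Balaban1984PropagatorsII, (2.12) p.225; Balaban1984PropagatorsI, (1.20) p.20] -/
theorem landauRepC_eq_iff_blockConst (x R : PBond (F.P K) 0 → ℂ) (Φ₀ : Site (F.P K) 0 → ℂ) (hx : ∀ b, x b = R b + (Φ₀ b.tgt - Φ₀ b.src))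
    (hRre : reBond F K R ∈ lan (F.P K) (k + 1) 1 1) (hRim : imBond F K R ∈ lan (F.P K) (k + 1) 1 1) :
    (∀ b, landauRepC F k K x b = R b) ↔
      (∃ κ : ℝ, siteAvgIter (k + 1) (fun y => (Φ₀ y).re) = fun _ => κ) ∧ (∃ κ : ℝ, siteAvgIter (k + 1) (fun y => (Φ₀ y).im) = fun _ => κ) := by
  -- the real and imaginary parts of `x` are gauge translates of those of `R`
  have hre : reBond F K x = reBond F K R + gradV1 (F.P K) 1 (WithLp.toLp 2 fun y => (Φ₀ y).re) := by
    apply WithLp.ofLp_injective 2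
    funext b
    simp [reBond, gradV1_apply, grad, hx b]
  have him : imBond F K x = imBond F K R + gradV1 (F.P K) 1 (WithLp.toLp 2 fun y => (Φ₀ y).im) := by
    apply WithLp.ofLp_injective 2
    funext b
    simp [imBond, gradV1_apply, grad, hx b]
  have hReq : landauRep F k K (reBond F K R) = reBond F K R := landauRep_eq_self_of_mem_lan F hk hRre
  have hIeq : landauRep F k K (imBond F K R) = imBond F K R := landauRep_eq_self_of_mem_lan F hk hRim
  constructor
  · intro h
    have hre' : landauRep F k K (reBond F K x) = reBond F K R := by
      apply WithLp.ofLp_injective 2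
      funext b
      have := congrArg Complex.re (h b)
      simpa [landauRepC, reBond] using this
    have him' : landauRep F k K (imBond F K x) = imBond F K R := by
      apply WithLp.ofLp_injective 2
      funext b
      have := congrArg Complex.im (h b)
      simpa [landauRepC, imBond] using this
    rw [hre] at hre'
    rw [him] at him'
    exact ⟨by simpa using blockConst_of_landauRep_add_grad F hk _ _ (hre'.trans hReq.symm),
      by simpa using blockConst_of_landauRep_add_grad F hk _ _ (him'.trans hIeq.symm)⟩
  · rintro ⟨⟨κ₁, h₁⟩, ⟨κ₂, h₂⟩⟩ b
    have e₁ : landauRep F k K (reBond F K x) = reBond F K R := by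
      rw [hre, landauRep_add_grad_of_blockConst F hk _ _ κ₁ (by simpa using h₁), hReq]
    have e₂ : landauRep F k K (imBond F K x) = imBond F K R := by
      rw [him, landauRep_add_grad_of_blockConst F hk _ _ κ₂ (by simpa using h₂), hIeq]
    apply Complex.ext
    · simp only [landauRepC, e₁, e₂]
      simp [reBond, imBond]
    · simp only [landauRepC, e₁, e₂]
      simp [reBond, imBond]

variable (θ : Stage13Params F 2)

/-- The real part of every entry of the chart-unit whole-torus localized response is a Landau field (a real multiple of `windowResp … univ l`). [cite: Balaban1987RG1, (4.35) p.290; Balaban1984PropagatorsII, (2.12) p.225] -/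
theorem reBond_recordHrLocξ_univ_mem_lan (a : θ.ιβ) (l : RespLabel F k K) (i i' : Fin 2) :
    reBond F K (fun b => recordHrLocξ F θ k K Finset.univ a l b i i') ∈ lan (F.P K) (k + 1) 1 1 := by
  letI := θ.instVβ₁; letI := θ.instVβ₂
  have e : reBond F K (fun b => recordHrLocξ F θ k K Finset.univ a l b i i') =
      ((F.P K).eta (k + 1) * (θ.ρ8 (θ.bV a) i i').re) • WithLp.toLp 2 (windowResp F k K Finset.univ l) := by
    apply WithLp.ofLp_injective 2
    funext b
    simp [reBond, recordHrLocξ, windowRespξ, Complex.mul_re]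
    ring
  rw [e]
  exact Submodule.smul_mem _ _ (toLp_windowResp_univ_mem_lan F hk l)

/-- The imaginary part of every entry of the chart-unit whole-torus localized response is a Landau field. [cite: Balaban1987RG1, (4.35) p.290; Balaban1984PropagatorsII, (2.12) p.225] -/
theorem imBond_recordHrLocξ_univ_mem_lan (a : θ.ιβ) (l : RespLabel F k K) (i i' : Fin 2) :
    imBond F K (fun b => recordHrLocξ F θ k K Finset.univ a l b i i') ∈ lan (F.P K) (k + 1) 1 1 := by
  letI := θ.instVβ₁; letI := θ.instVβ₂
  have e : imBond F K (fun b => recordHrLocξ F θ k K Finset.univ a l b i i') =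
      ((F.P K).eta (k + 1) * (θ.ρ8 (θ.bV a) i i').im) • WithLp.toLp 2 (windowResp F k K Finset.univ l) := by
    apply WithLp.ofLp_injective 2
    funext b
    simp [imBond, recordHrLocξ, windowRespξ, Complex.mul_im]
    ring
  rw [e]
  exact Submodule.smul_mem _ _ (toLp_windowResp_univ_mem_lan F hk l)

/-- ★★★ **THE SELECTOR-FREE CRITERION FOR Tok-182 AT `(θ, K, a, l)`.**  Suppose the rooted response has the (T‴)-SHAPE: for some entrywise site potential `Φ`,
`recordD a l b i i′ = recordHrLocξ univ a l b i i′ + (Φ b₊ i i′ − Φ b₋ i i′)` (DISPLAYED — the linear-order content of [15] (182) in the tree's gauges; nothing about the selector is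
proved here).  THEN Tok-182 at `(θ, K, a, l)` — `recordHr a l = recordHrLocξ univ a l` — holds **iff the `(k+1)`-block means of `re Φ_{ii′}` and `im Φ_{ii′}` are CONSTANT for
every entry** (CRIT-1 04:49:39Z (1): «ZERO iff m is block-constant», `Q′_{k+1}Φ = −m + const`; memo v2: not constant already at `k = 0`, `d = 4`).
[cite: Balaban1985Variational, (182) p.307, (21) p.281; Balaban1984PropagatorsII, (2.12) p.225; Balaban1985Averaging, (125) p.36; Balaban1987RG1, (4.35) p.290] -/
theorem tok182At_iff_blockConst_of_gaugeShape (a : θ.ιβ) (l : RespLabel F k K) (Φ : Site (F.P K) 0 → Fin 2 → Fin 2 → ℂ)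
    (hT : ∀ (b : PBond (F.P K) 0) (i i' : Fin 2),
      recordD F θ k K a l b i i' = recordHrLocξ F θ k K Finset.univ a l b i i' + (Φ b.tgt i i' - Φ b.src i i')) :
    (∀ b : PBond (F.P K) 0, recordHr F θ k K a l b = recordHrLocξ F θ k K Finset.univ a l b) ↔
      ∀ i i' : Fin 2, (∃ κ : ℝ, siteAvgIter (k + 1) (fun y => (Φ y i i').re) = fun _ => κ) ∧
        (∃ κ : ℝ, siteAvgIter (k + 1) (fun y => (Φ y i i').im) = fun _ => κ) := by
  have key : ∀ i i' : Fin 2, (∀ b, recordHr F θ k K a l b i i' = recordHrLocξ F θ k K Finset.univ a l b i i') ↔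
      (∃ κ : ℝ, siteAvgIter (k + 1) (fun y => (Φ y i i').re) = fun _ => κ) ∧ (∃ κ : ℝ, siteAvgIter (k + 1) (fun y => (Φ y i i').im) = fun _ => κ) :=
    fun i i' => landauRepC_eq_iff_blockConst F hk (fun b => recordD F θ k K a l b i i') (fun b => recordHrLocξ F θ k K Finset.univ a l b i i')
      (fun y => Φ y i i') (fun b => hT b i i') (reBond_recordHrLocξ_univ_mem_lan F hk θ a l i i') (imBond_recordHrLocξ_univ_mem_lan F hk θ a l i i')
  constructor
  · intro h i i'
    exact (key i i').1 fun b => by rw [h b]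
  · intro h b
    funext i i'
    exact (key i i').2 (h i i') b

/-- **One-way corollary (the refutation road under the (T‴)-shape)**: ONE entry whose gauge potential has a NON-constant `(k+1)`-block mean refutes Tok-182 at `(θ, K, a, l)`.
[cite: Balaban1985Variational, (182) p.307; Balaban1985Averaging, (125) p.36] -/
theorem not_tok182At_of_gaugeShape_of_not_blockConst (a : θ.ιβ) (l : RespLabel F k K) (Φ : Site (F.P K) 0 → Fin 2 → Fin 2 → ℂ)
    (hT : ∀ (b : PBond (F.P K) 0) (i i' : Fin 2),
      recordD F θ k K a l b i i' = recordHrLocξ F θ k K Finset.univ a l b i i' + (Φ b.tgt i i' - Φ b.src i i'))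
    (i i' : Fin 2) (hne : ¬ ∃ κ : ℝ, siteAvgIter (k + 1) (fun y => (Φ y i i').re) = fun _ => κ) :
    ¬ ∀ b : PBond (F.P K) 0, recordHr F θ k K a l b = recordHrLocξ F θ k K Finset.univ a l b :=
  fun h => hne ((tok182At_iff_blockConst_of_gaugeShape F hk θ a l Φ hT).1 h i i').1

end Names

end Summit.QuantumFields.YangMills.Theorems.PortTok182

end
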